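import Literature.Probability.RandomPlanarGeometry.HullKernelLimit
import Literature.Probability.RandomPlanarGeometry.SLETraceEightKernel
import Literature.Probability.RandomPlanarGeometry.HydrodynamicMaps
import Literature.Probability.RandomPlanarGeometry.HalfPlaneFill
import Literature.Probability.RandomPlanarGeometry.CaratheodoryHalfPlane
import HarnessLib

/-!
# The Carathéodory kernel theorem for half-plane hulls converging in the Hausdorff sense

Topic `Literature/Probability/RandomPlanarGeometry` (family `crit-ising`); theorems only, no
definition and no named fact.

A. Kemppainen, S. Smirnov, *Random curves, scaling limits and Loewner evolutions*, Ann. Probab.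
45 (2017) 698–779 (arXiv:1212.6215), Appendix A, Lemma A.2 (arXiv Lemma 5.3): "Let `γ_n` be a
sequence of curves in `ℍ` and let `γ` be a curve in `ℍ` … let `g_{n,t}` and `g_t` be the
normalized conformal maps related to the hulls `K_{n,t}` and `K_t` of `γ_n[0,t]` and `γ[0,t]`,
respectively. If `γ_n → γ` uniformly, then `g_{n,t} → g_t` uniformly on `S_K(T, δ)`. Especially
`hcap γ_n[0, ·] → hcap γ[0, ·]` uniformly", with the one-line proof "The lemma follows from the
Carathéodory convergence theorem (Theorem 3.1 of [Duren 1983] and Theorem 1.8 of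
[Pommerenke 1992])". This is the ingredient of the main lemma (Lemma A.4/A.5, the construction
of the Loewner chain of a limit of simple curves) that is not yet in the tree: the tree has the
driving-term stability (Lemma A.3 = Lawler–Schramm–Werner 2004, Lemma 3.14 (i),
`SLETraceEight.lean`), the kernel step for LOEWNER chains with converging driving terms
(`SLETraceEightKernel.lean`, Lemma 3.14 (ii)) and the equicontinuity Lemma A.1
(`LoewnerInverseContinuity.lean`; the elementary helpers `Loewner.isPreconnected_thickening`,
`Loewner.subset_unboundedComponent_of_mem`, `Loewner.tendstoLocallyUniformlyOn_comp_of_tendsto_atTop`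
of `SLETraceEightKernel.lean` are reused here), but no statement comparing the hydrodynamically normalized
maps `g_A` (Lawler (2005), Prop. 3.36; the tree's `IsHydrodynamicMap`, `HydrodynamicMaps.lean`)
of hulls that are merely close as SETS.

This file PROVES the kernel theorem in that setting. Data: sets `S_n, S ⊆ B̄(0, R)` (the traces
`γ_n[0, t]`, `γ[0, t]`), sets `K_n, K` with `ℍ ∖ K_n`, `ℍ ∖ K` the unbounded components of
`ℍ ∖ S_n`, `ℍ ∖ S` (the hulls "related to" the traces; `Loewner.unboundedComponent`,
`HalfPlaneFill.lean`), hydrodynamic maps `g_n : ℍ ∖ K_n → ℍ`, `g : ℍ ∖ K → ℍ`, and the two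
halves of Hausdorff convergence `S_n → S`: eventually `S_n ⊆ S^ε` and `S ⊆ S_n^ε` for every
`ε > 0` (`Metric.thickening`). Results:

* `IsHydrodynamicMap.eqOn_of_isHydrodynamicMap` — **uniqueness of `g_A`** (Lawler (2005),
  Prop. 3.36: "the unique conformal transformation … with `g_A(z) - z → 0`"), from the rigidity
  lemma `Complex.eqOn_id_of_tendsto_sub_self`;
* `eventually_subset_diff_of_thickening` — a connected set `Δ ⊆ ℍ` whose `ε`-neighbourhood
  misses `S` and which reaches beyond `B̄(0, R)` lies in `ℍ ∖ K_n` for all large `n`;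
* `exists_nhd_tendstoLocallyUniformlyOn_of_thickening` — the Montel step: every `w ∈ ℍ ∖ K` has
  a connected open neighbourhood `Δ ⊆ ℍ ∖ K` on which every subsequence of `(g_n)` has a further
  subsequence converging locally uniformly to a holomorphic map INTO `ℍ` (the limit is anchored
  in `ℍ` at a far point of `Δ`, where `|g_n(z) - z| ≤ 1152 R²/|z|` uniformly in `n`, and the
  maximum modulus principle for its Cayley transform propagates this along `Δ`);
* **`tendstoLocallyUniformlyOn_symm_of_thickening`** — `g_n⁻¹ → g⁻¹` locally uniformly on `ℍ`
  (Montel for `g_n⁻¹ - id`, bounded by `580 R`; the limit is univalent by Hurwitz, misses `S`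
  by Rouché against targets `q_n ∈ S_n`, `q_n → p`, hence maps into the unbounded component
  `ℍ ∖ K`, is onto it by the previous item, and is hydrodynamically normalized, so equals `g⁻¹`
  by uniqueness; the subsequence principle concludes);
* **`tendstoLocallyUniformlyOn_of_thickening`** — `g_n → g` locally uniformly on `ℍ ∖ K`.

The convergence of the capacities `hcap K_n → hcap K` (the "Especially" of Lemma A.2) and the
curve form are derived from these in a sibling file.

## References

* A. Kemppainen, S. Smirnov, Ann. Probab. 45 (2017), App. A, Lemma A.2 (arXiv:1212.6215,
  Lemma 5.3). [KemppainenSmirnov2017]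
* Ch. Pommerenke, *Boundary Behaviour of Conformal Maps*, Springer (1992), Thm. 1.8
  (Carathéodory kernel theorem). [PommerenkeBBCM1992]
* G. F. Lawler, *Conformally Invariant Processes in the Plane*, AMS (2005), §3.4 Prop. 3.36,
  (3.12), Prop. 3.46; §3.6 Prop. 3.63, 3.68. [Lawler2005]
* J. B. Conway, *Functions of One Complex Variable I* (1978), VII.2.5 (Hurwitz), VII.2.9
  (Montel). [Conway1978]
-/

noncomputable section

open Set Filter Topology Metric Bornology Complex Function
open UpperHalfPlane (upperHalfPlaneSet isOpen_upperHalfPlaneSet)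

namespace Literature.Probability.RandomPlanarGeometry

/-! ### Preliminaries: subsequences -/

/-- **Subsequence principle for uniform convergence on a set**: if every subsequence has a
further subsequence converging uniformly on `s` to `f`, the sequence converges uniformly on `s`
to `f`. [folklore] -/
theorem tendstoUniformlyOn_of_forall_strictMono {α β : Type*} [PseudoMetricSpace β]
    {F : ℕ → α → β} {f : α → β} {s : Set α}
    (h : ∀ ψ : ℕ → ℕ, StrictMono ψ →
      ∃ σ : ℕ → ℕ, StrictMono σ ∧ TendstoUniformlyOn (fun k ↦ F (ψ (σ k))) f atTop s) :
    TendstoUniformlyOn F f atTop s := by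
  rw [Metric.tendstoUniformlyOn_iff]
  intro ε hε
  by_contra hcon
  rw [not_eventually] at hcon
  obtain ⟨ψ, hψ, hbad⟩ := extraction_of_frequently_atTop hcon
  obtain ⟨σ, -, hlim⟩ := h ψ hψ
  obtain ⟨k, hk⟩ := ((Metric.tendstoUniformlyOn_iff.1 hlim) ε hε).exists
  have hb := hbad (σ k)
  push Not at hb
  obtain ⟨x, hx, hxε⟩ := hb
  exact absurd (hk x hx) (not_lt.2 hxε)

/-- **Subsequence principle for locally uniform convergence on an open set of `ℂ`.**
[folklore] -/
theorem tendstoLocallyUniformlyOn_of_forall_strictMono {U : Set ℂ} (hU : IsOpen U)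
    {F : ℕ → ℂ → ℂ} {f : ℂ → ℂ}
    (h : ∀ ψ : ℕ → ℕ, StrictMono ψ →
      ∃ σ : ℕ → ℕ, StrictMono σ ∧ TendstoLocallyUniformlyOn (fun k ↦ F (ψ (σ k))) f atTop U) :
    TendstoLocallyUniformlyOn F f atTop U := by
  rw [tendstoLocallyUniformlyOn_iff_forall_isCompact hU]
  intro L hLU hL
  refine tendstoUniformlyOn_of_forall_strictMono fun ψ hψ ↦ ?_
  obtain ⟨σ, hσ, hlim⟩ := h ψ hψ
  exact ⟨σ, hσ, (tendstoLocallyUniformlyOn_iff_forall_isCompact hU).1 hlim L hLU hL⟩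

/-- **Approximating points in a Hausdorff-approximating sequence of sets**: if `p ∈ (T_n)^ε`
eventually for every `ε > 0`, there are points `q_n → p` with `q_n ∈ T_n` eventually.
[folklore] -/
theorem exists_seq_tendsto_mem_of_thickening {T : ℕ → Set ℂ} {p : ℂ}
    (h : ∀ ε > 0, ∀ᶠ n in atTop, p ∈ thickening ε (T n)) :
    ∃ q : ℕ → ℂ, Tendsto q atTop (𝓝 p) ∧ ∀ᶠ n in atTop, q n ∈ T n := by
  classical
  have hex : ∀ n : ℕ, (T n).Nonempty →
      ∃ x ∈ T n, dist p x < infDist p (T n) + 1 / ((n : ℝ) + 1) := fun n hn ↦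
    (infDist_lt_iff hn).1 (by linarith [show (0 : ℝ) < 1 / ((n : ℝ) + 1) by positivity])
  set q : ℕ → ℂ := fun n ↦ if hn : (T n).Nonempty then (hex n hn).choose else p with hq
  have hqmem : ∀ n, (T n).Nonempty →
      q n ∈ T n ∧ dist p (q n) < infDist p (T n) + 1 / ((n : ℝ) + 1) := by
    intro n hn
    simp only [hq, dif_pos hn]
    exact (hex n hn).choose_spec
  have hne : ∀ᶠ n in atTop, (T n).Nonempty := by
    filter_upwards [h 1 one_pos] with n hn
    by_contra hcon
    rw [not_nonempty_iff_eq_empty] at hcon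
    rw [hcon, thickening_empty] at hn
    exact hn
  refine ⟨q, ?_, ?_⟩
  · rw [Metric.tendsto_nhds]
    intro ε hε
    have h3 : ∀ᶠ n : ℕ in atTop, 1 / ((n : ℝ) + 1) < ε / 2 :=
      (tendsto_one_div_add_atTop_nhds_zero_nat).eventually (gt_mem_nhds (half_pos hε))
    filter_upwards [h (ε / 2) (half_pos hε), hne, h3] with n hn hn' hn3
    have h4 : infDist p (T n) < ε / 2 := (mem_thickening_iff_infDist_lt hn').1 hn
    rw [dist_comm]
    linarith [(hqmem n hn').2]
  · filter_upwards [hne] with n hn using (hqmem n hn).1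

/-- A map at bounded distance from the identity tends to `∞` with its argument. [folklore] -/
theorem tendsto_cocompact_of_norm_sub_self_le {l : Filter ℂ} {f : ℂ → ℂ} {C : ℝ}
    (hl : l ≤ cocompact ℂ) (h : ∀ᶠ w in l, ‖f w - w‖ ≤ C) : Tendsto f l (cocompact ℂ) := by
  rw [← cobounded_eq_cocompact, ← tendsto_norm_atTop_iff_cobounded]
  have h1 : Tendsto (fun w : ℂ ↦ ‖w‖ + -C) l atTop :=
    tendsto_atTop_add_const_right _ _ (tendsto_norm_cobounded_atTop.mono_left
      (by rwa [cobounded_eq_cocompact]))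
  refine tendsto_atTop_mono' l ?_ h1
  filter_upwards [h] with w hw
  linarith [norm_le_norm_sub_add w (f w), norm_sub_rev w (f w)]

/-! ### Uniqueness of the hydrodynamically normalized map -/

/-- **Uniqueness of `g_A`** (Lawler (2005), Prop. 3.36: `g_A` is "the unique conformal
transformation of `ℍ ∖ A` onto `ℍ` such that `g_A(z) - z → 0`"): two hydrodynamically
normalized conformal maps `ℍ ∖ K → ℍ` agree on `ℍ ∖ K` (`φ₂ ∘ φ₁⁻¹` is an automorphism of `ℍ`
with the hydrodynamic normalization, hence the identity, `Complex.eqOn_id_of_tendsto_sub_self`).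
[cite: Lawler2005, §3.4 Prop. 3.36] -/
theorem IsHydrodynamicMap.eqOn_of_isHydrodynamicMap {K : Set ℂ}
    {φ₁ φ₂ : ConformalEquiv (upperHalfPlaneSet \ K) upperHalfPlaneSet}
    (h₁ : IsHydrodynamicMap K φ₁) (h₂ : IsHydrodynamicMap K φ₂)
    (hb : IsBounded (K ∩ upperHalfPlaneSet)) : EqOn φ₁ φ₂ (upperHalfPlaneSet \ K) := by
  -- `φᵢ⁻¹ → ∞` within `ℍ ∖ K` as the argument tends to `∞` in `ℍ`
  have hsymm : ∀ {ψ : ConformalEquiv (upperHalfPlaneSet \ K) upperHalfPlaneSet},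
      IsHydrodynamicMap K ψ →
        Tendsto ψ.symm (cocompact ℂ ⊓ 𝓟 upperHalfPlaneSet)
          (cocompact ℂ ⊓ 𝓟 (upperHalfPlaneSet \ K)) := by
    intro ψ hψ
    refine tendsto_inf.2 ⟨tendsto_cocompact_of_sub_self inf_le_left (hψ.tendsto_symm_sub_self hb),
      tendsto_principal.2 ?_⟩
    filter_upwards [mem_inf_of_right (mem_principal_self _)] with w hw using ψ.symm_mapsTo hw
  -- the compositions `φ₂ ∘ φ₁⁻¹`, `φ₁ ∘ φ₂⁻¹` are hydrodynamically normalized self-maps of `ℍ`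
  have hlim : ∀ {ψ χ : ConformalEquiv (upperHalfPlaneSet \ K) upperHalfPlaneSet},
      IsHydrodynamicMap K ψ → IsHydrodynamicMap K χ →
        Tendsto (fun w ↦ χ (ψ.symm w) - w) (cocompact ℂ ⊓ 𝓟 upperHalfPlaneSet) (𝓝 0) := by
    intro ψ χ hψ hχ
    have ha : Tendsto (fun w ↦ χ (ψ.symm w) - ψ.symm w) (cocompact ℂ ⊓ 𝓟 upperHalfPlaneSet)
        (𝓝 0) := Tendsto.comp (show Tendsto _ _ _ from hχ) (hsymm hψ)
    have hsum := ha.add (hψ.tendsto_symm_sub_self hb)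
    rw [add_zero] at hsum
    exact hsum.congr fun w ↦ by ring
  have hd : ∀ {ψ χ : ConformalEquiv (upperHalfPlaneSet \ K) upperHalfPlaneSet},
      DifferentiableOn ℂ (fun w ↦ χ (ψ.symm w)) upperHalfPlaneSet := fun {ψ χ} ↦
    χ.differentiableOn_coe.comp ψ.symm.differentiableOn_coe ψ.symm_mapsTo
  have hmaps : ∀ {ψ χ : ConformalEquiv (upperHalfPlaneSet \ K) upperHalfPlaneSet},
      MapsTo (fun w ↦ χ (ψ.symm w)) upperHalfPlaneSet upperHalfPlaneSet := fun {ψ χ} w hw ↦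
    χ.mapsTo (ψ.symm_mapsTo hw)
  have hid := Complex.eqOn_id_of_tendsto_sub_self (g := fun w ↦ φ₂ (φ₁.symm w))
    (G := fun w ↦ φ₁ (φ₂.symm w)) hd hmaps (hlim h₁ h₂) hd hmaps (hlim h₂ h₁) (fun w hw ↦ by
      simp only
      rw [φ₂.symm_apply_apply (φ₁.symm_mapsTo hw), φ₁.apply_symm_apply hw])
  intro z hz
  have h := hid (φ₁.mapsTo hz)
  simp only [id_eq] at h
  rw [φ₁.symm_apply_apply hz] at h
  exact h.symm

/-! ### Bounds for hydrodynamic maps of hulls inside `B̄(0, R)` -/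

/-- If `ℍ ∖ K` is the unbounded component of `ℍ ∖ S` with `S ⊆ B̄(0, R)`, then
`K ∩ ℍ ⊆ B̄(0, R)`. [folklore] -/
theorem inter_subset_closedBall_of_diff_eq {S K : Set ℂ} {R : ℝ} (hSR : S ⊆ closedBall (0 : ℂ) R)
    (hV : upperHalfPlaneSet \ K = Loewner.unboundedComponent (upperHalfPlaneSet \ S)) :
    K ∩ upperHalfPlaneSet ⊆ closedBall ((0 : ℝ) : ℂ) R := by
  intro z hz
  rw [ofReal_zero, mem_closedBall, dist_zero_right]
  by_contra hcon
  rw [not_le] at hcon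
  have hmem : z ∈ upperHalfPlaneSet \ K := by
    rw [hV]
    exact mem_unboundedComponent_of_lt_norm hSR hz.2 hcon
  exact hmem.2 hz.1

/-- **Far-field bound** `|φ(z) - z| ≤ 1152 R²/|z|` for `z ∈ ℍ`, `|z| ≥ 2R`, when
`K ∩ ℍ ⊆ B̄(0, R)` (Lawler (2005), Prop. 3.46 with `hcap ≤ 288 R²`).
[cite: Lawler2005, Prop. 3.46] -/
theorem IsHydrodynamicMap.norm_sub_self_le_div {K : Set ℂ}
    {φ : ConformalEquiv (upperHalfPlaneSet \ K) upperHalfPlaneSet} (hφ : IsHydrodynamicMap K φ)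
    {R : ℝ} (hK : K ∩ upperHalfPlaneSet ⊆ closedBall ((0 : ℝ) : ℂ) R) (hR : 0 < R) {z : ℂ}
    (hz : z ∈ upperHalfPlaneSet) (h2 : 2 * R ≤ ‖z‖) : ‖φ z - z‖ ≤ 1152 * R ^ 2 / ‖z‖ := by
  set a : ℝ := hcap K φ with ha
  have ha0 : 0 ≤ a := hφ.hcap_nonneg (IsHydrodynamicMap.isBounded_of_subset hK)
  have haR : a ≤ 288 * R ^ 2 := hφ.hcap_le hK hR
  have hz0 : 0 < ‖z‖ := by linarith
  have h1 := hφ.norm_sub_sub_div_le hK hR hz (by rw [ofReal_zero, sub_zero]; exact h2)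
  rw [ofReal_zero, sub_zero] at h1
  -- `|φ z - z| ≤ |φ z - z - a/z| + |a/z|`
  have h3 : ‖φ z - z‖ ≤ ‖φ z - z - a / z‖ + ‖(a : ℂ) / z‖ := by
    calc ‖φ z - z‖ = ‖(φ z - z - a / z) + a / z‖ := by rw [sub_add_cancel]
      _ ≤ _ := norm_add_le _ _
  have h4 : ‖(a : ℂ) / z‖ = a / ‖z‖ := by
    rw [norm_div, Complex.norm_real, Real.norm_of_nonneg ha0]
  have h5 : 6 * a * R / ‖z‖ ^ 2 ≤ 3 * a / ‖z‖ := by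
    rw [div_le_div_iff₀ (by positivity) hz0]
    have h7 : 6 * a * R ≤ 3 * a * ‖z‖ := by nlinarith [ha0, h2]
    have h8 := mul_le_mul_of_nonneg_right h7 (norm_nonneg z)
    nlinarith [h8]
  have h6 : ‖φ z - z‖ ≤ 4 * a / ‖z‖ := by
    have := h3.trans (add_le_add (h1.trans h5) h4.le)
    have e : 3 * a / ‖z‖ + a / ‖z‖ = 4 * a / ‖z‖ := by ring
    linarith
  refine h6.trans ?_
  rw [div_le_div_iff_of_pos_right hz0]
  linarith

/-! ### The kernel theorem -/

section Kernel

variable {S K : Set ℂ} {φ : ConformalEquiv (upperHalfPlaneSet \ K) upperHalfPlaneSet}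
  {Sn Kn : ℕ → Set ℂ} {φn : ∀ n, ConformalEquiv (upperHalfPlaneSet \ Kn n) upperHalfPlaneSet}
  {R : ℝ}

/-- **A connected set with a margin to `S` eventually avoids the hulls `K_n`.** Let
`ℍ ∖ K_n` be the unbounded component of `ℍ ∖ S_n` with `S_n ⊆ B̄(0, R)` and eventually
`S_n ⊆ S^ε`. If `Δ ⊆ ℍ` is preconnected, its `ε`-neighbourhood misses `S`, and `Δ` contains a
point of norm `> R`, then `Δ ⊆ ℍ ∖ K_n` for all large `n`. [folklore] -/
theorem eventually_subset_diff_of_thickening (hSnR : ∀ n, Sn n ⊆ closedBall (0 : ℂ) R)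
    (hVn : ∀ n, upperHalfPlaneSet \ Kn n = Loewner.unboundedComponent (upperHalfPlaneSet \ Sn n))
    (h1 : ∀ ε > 0, ∀ᶠ n in atTop, Sn n ⊆ thickening ε S)
    {Δ : Set ℂ} (hΔc : IsPreconnected Δ) (hΔH : Δ ⊆ upperHalfPlaneSet) {ε : ℝ} (hε : 0 < ε)
    (hΔS : Disjoint (thickening ε Δ) S) {z₁ : ℂ} (hz₁ : z₁ ∈ Δ) (hz₁R : R < ‖z₁‖) :
    ∀ᶠ n in atTop, Δ ⊆ upperHalfPlaneSet \ Kn n := by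
  filter_upwards [h1 ε hε] with n hn
  rw [hVn n]
  have hΔF : Δ ⊆ upperHalfPlaneSet \ Sn n := fun y hy ↦ ⟨hΔH hy, fun hyS ↦ by
    obtain ⟨s, hs, hys⟩ := mem_thickening_iff.1 (hn hyS)
    exact Set.disjoint_left.1 hΔS (mem_thickening_iff.2 ⟨y, hy, by rwa [dist_comm]⟩) hs⟩
  exact Loewner.subset_unboundedComponent_of_mem hΔc hΔF hz₁
    (mem_unboundedComponent_of_lt_norm (hSnR n) (hΔH hz₁) hz₁R)

/-- **The Montel step of the kernel theorem.** Let `g_n : ℍ ∖ K_n → ℍ` be hydrodynamically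
normalized, `ℍ ∖ K_n` the unbounded component of `ℍ ∖ S_n`, `S_n, S ⊆ B̄(0, R)`, eventually
`S_n ⊆ S^ε` for every `ε > 0`, and let `ℍ ∖ K` be the unbounded component of `ℍ ∖ S` (open and
connected, witnessed by a conformal map `φ : ℍ ∖ K → ℍ`). Then every `w ∈ ℍ ∖ K` has a
connected open neighbourhood `Δ ⊆ ℍ ∖ K` such that for every subsequence `ψ` there are a further
subsequence `σ` with `Δ ⊆ ℍ ∖ K_{ψ(σ(k))}` for all `k` and a holomorphic `g : Δ → ℍ` with
`g_{ψ(σ(k))} → g` locally uniformly on `Δ`. (`Δ` is a thin neighbourhood of a path in `ℍ ∖ K`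
from `w` to a far point `z₁ = iY`; Montel for `g_n - id`, bounded by `580 R`; the limit has
`im ≥ 0`, and `im > 0` because `|g_n(z₁) - z₁| ≤ 1/2` uniformly in `n` and the Cayley transform
of the limit, of modulus `≤ 1` and `< 1` at `z₁`, has modulus `< 1` throughout the connected
`Δ` by the maximum modulus principle.) [cite: PommerenkeBBCM1992, Thm. 1.8]
[cite: KemppainenSmirnov2017, App. A Lemma A.2] -/
theorem exists_nhd_tendstoLocallyUniformlyOn_of_thickening (hR : 0 < R)
    (hSR : S ⊆ closedBall (0 : ℂ) R) (hSnR : ∀ n, Sn n ⊆ closedBall (0 : ℂ) R)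
    (hV : upperHalfPlaneSet \ K = Loewner.unboundedComponent (upperHalfPlaneSet \ S))
    (hVn : ∀ n, upperHalfPlaneSet \ Kn n = Loewner.unboundedComponent (upperHalfPlaneSet \ Sn n))
    (φ : ConformalEquiv (upperHalfPlaneSet \ K) upperHalfPlaneSet)
    (hφn : ∀ n, IsHydrodynamicMap (Kn n) (φn n))
    (h1 : ∀ ε > 0, ∀ᶠ n in atTop, Sn n ⊆ thickening ε S)
    {w : ℂ} (hw : w ∈ upperHalfPlaneSet \ K) :
    ∃ Δ : Set ℂ, IsOpen Δ ∧ w ∈ Δ ∧ Δ ⊆ upperHalfPlaneSet \ K ∧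
      ∀ ψ : ℕ → ℕ, StrictMono ψ → ∃ σ : ℕ → ℕ, StrictMono σ ∧
        (∀ k, Δ ⊆ upperHalfPlaneSet \ Kn (ψ (σ k))) ∧
        ∃ g : ℂ → ℂ, DifferentiableOn ℂ g Δ ∧ MapsTo g Δ upperHalfPlaneSet ∧
          TendstoLocallyUniformlyOn (fun k z ↦ φn (ψ (σ k)) z) g atTop Δ := by
  have hVo : IsOpen (upperHalfPlaneSet \ K) := IsHydrodynamicMap.isOpen_diff φ
  have hVc : IsConnected (upperHalfPlaneSet \ K) := IsHydrodynamicMap.isConnected_diff φ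
  have hVS : upperHalfPlaneSet \ K ⊆ upperHalfPlaneSet \ S := by
    rw [hV]; exact Loewner.unboundedComponent_subset _
  -- uniform bounds for the maps `g_n`
  have hKnR : ∀ n, Kn n ∩ upperHalfPlaneSet ⊆ closedBall ((0 : ℝ) : ℂ) R := fun n ↦
    inter_subset_closedBall_of_diff_eq (hSnR n) (hVn n)
  set C : ℝ := 580 * R with hC
  have hCn : ∀ n, ∀ z ∈ upperHalfPlaneSet \ Kn n, ‖φn n z - z‖ ≤ C := fun n z hz ↦
    (hφn n).norm_sub_self_le (hKnR n) hR hz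
  have hfar : ∀ n, ∀ z ∈ upperHalfPlaneSet, 2 * R ≤ ‖z‖ → ‖φn n z - z‖ ≤ 1152 * R ^ 2 / ‖z‖ :=
    fun n z hz h2 ↦ (hφn n).norm_sub_self_le_div (hKnR n) hR hz h2
  -- the far point `z₁ = iY`
  set Y : ℝ := 2 * R + 2304 * R ^ 2 + 2 with hY
  have hY0 : 0 < Y := by positivity
  have hYR : R < Y := by rw [hY]; nlinarith
  have hY2R : 2 * R ≤ Y := by rw [hY]; nlinarith
  set z₁ : ℂ := (Y : ℂ) * I with hz₁
  have hz₁im : z₁.im = Y := by simp [hz₁]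
  have hz₁H : z₁ ∈ upperHalfPlaneSet := by
    change 0 < z₁.im
    rwa [hz₁im]
  have hz₁n : ‖z₁‖ = Y := by
    rw [hz₁, norm_mul, norm_I, mul_one, Complex.norm_real, Real.norm_eq_abs, abs_of_pos hY0]
  have hz₁V : z₁ ∈ upperHalfPlaneSet \ K := by
    rw [hV]
    exact mem_unboundedComponent_of_lt_norm hSR hz₁H (by rwa [hz₁n])
  have hfar₁ : ∀ n, ‖φn n z₁ - z₁‖ ≤ 1 / 2 := fun n ↦ by
    refine (hfar n z₁ hz₁H (by rwa [hz₁n])).trans ?_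
    rw [hz₁n, div_le_div_iff₀ hY0 two_pos]
    have : Y ≥ 2304 * R ^ 2 := by rw [hY]; nlinarith
    nlinarith
  -- a path from `w` to `z₁` in `V` and a thin connected open neighbourhood `Δ` of it
  obtain ⟨p, hp⟩ : JoinedIn (upperHalfPlaneSet \ K) w z₁ :=
    ((hVo.isConnected_iff_isPathConnected).1 hVc).joinedIn w hw z₁ hz₁V
  set P : Set ℂ := range p with hP
  have hPc : IsCompact P := isCompact_range p.continuous
  have hPconn : IsPreconnected P := isPreconnected_range p.continuous
  have hPV : P ⊆ upperHalfPlaneSet \ K := by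
    rintro _ ⟨x, rfl⟩
    exact hp x
  have hwP : w ∈ P := ⟨0, p.source⟩
  have hz₁P : z₁ ∈ P := ⟨1, p.target⟩
  obtain ⟨ε2, hε2, hcth⟩ := hPc.exists_cthickening_subset_open hVo hPV
  set ε : ℝ := ε2 / 2 with hε
  have hε0 : 0 < ε := by positivity
  set Δ : Set ℂ := thickening ε P with hΔ
  have hΔo : IsOpen Δ := isOpen_thickening
  have hΔconn : IsPreconnected Δ := Loewner.isPreconnected_thickening hPconn hε0
  have hΔV : Δ ⊆ upperHalfPlaneSet \ K :=
    ((thickening_mono (by linarith) P).trans (thickening_subset_cthickening ε2 P)).trans hcth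
  have hΔH : Δ ⊆ upperHalfPlaneSet := fun z hz ↦ (hΔV hz).1
  have hwΔ : w ∈ Δ := self_subset_thickening hε0 P hwP
  have hz₁Δ : z₁ ∈ Δ := self_subset_thickening hε0 P hz₁P
  -- the `ε`-neighbourhood of `Δ` misses `S`
  have hΔS : Disjoint (thickening ε Δ) S := by
    rw [Set.disjoint_left]
    intro y hy hyS
    obtain ⟨d, hd, hyd⟩ := mem_thickening_iff.1 hy
    obtain ⟨k, hk, hdk⟩ := mem_thickening_iff.1 hd
    have h3 : y ∈ thickening ε2 P := mem_thickening_iff.2 ⟨k, hk, by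
      calc dist y k ≤ dist y d + dist d k := dist_triangle _ _ _
        _ < ε + ε := add_lt_add hyd hdk
        _ = ε2 := by rw [hε]; ring⟩
    exact (hVS (hcth (thickening_subset_cthickening ε2 P h3))).2 hyS
  -- eventually `Δ ⊆ ℍ ∖ K_n`
  obtain ⟨N, hN⟩ := eventually_atTop.1 (eventually_subset_diff_of_thickening hSnR hVn h1
    hΔconn hΔH hε0 hΔS hz₁Δ (by rwa [hz₁n]))
  refine ⟨Δ, hΔo, hwΔ, hΔV, fun ψ hψ ↦ ?_⟩
  -- the tail of the subsequence `ψ` where `Δ ⊆ ℍ ∖ K_{ψ(k + N)}`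
  have htail : ∀ k, Δ ⊆ upperHalfPlaneSet \ Kn (ψ (k + N)) := fun k ↦
    hN _ ((Nat.le_add_left N k).trans (hψ.id_le _))
  -- Montel for `g_{ψ(k+N)} - id` on `Δ`
  set F : ℕ → ℂ → ℂ := fun k z ↦ φn (ψ (k + N)) z - z with hF
  have hFd : ∀ k, DifferentiableOn ℂ (F k) Δ := fun k ↦
    ((φn _).differentiableOn_coe.mono (htail k)).sub differentiableOn_id
  have hFb : ∀ k, ∀ z ∈ Δ, ‖F k z‖ ≤ C := fun k z hz ↦ hCn _ z (htail k hz)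
  obtain ⟨g₀, σ₀, hσ₀, hg₀d, hlim₀, -⟩ :=
    Complex.exists_strictMono_tendstoLocallyUniformlyOn_of_norm_le hΔo hFd hFb
  set g : ℂ → ℂ := fun z ↦ g₀ z + z with hg
  have hlim : TendstoLocallyUniformlyOn (fun k z ↦ φn (ψ (σ₀ k + N)) z) g atTop Δ := by
    have := tendstoLocallyUniformlyOn_add_id hlim₀
    simp only [hF, sub_add_cancel] at this
    exact this
  have hgd : DifferentiableOn ℂ g Δ := hg₀d.add differentiableOn_id
  -- `im g ≥ 0` on `Δ`
  have him : ∀ z ∈ Δ, 0 ≤ (g z).im := fun z hz ↦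
    ge_of_tendsto ((continuous_im.tendsto _).comp (hlim.tendsto_at hz))
      (Eventually.of_forall fun k ↦
        (show 0 < (φn (ψ (σ₀ k + N)) z).im from (φn _).mapsTo (htail (σ₀ k) hz)).le)
  -- the anchor: `|g z₁ - z₁| ≤ 1/2`, so `im (g z₁) > 0`
  have hgz₁ : ‖g z₁ - z₁‖ ≤ 1 / 2 :=
    le_of_tendsto ((hlim.tendsto_at hz₁Δ).sub_const z₁).norm
      (Eventually.of_forall fun k ↦ hfar₁ _)
  have hgz₁im : 0 < (g z₁).im := by
    have h := abs_im_le_norm (g z₁ - z₁)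
    rw [sub_im, hz₁im] at h
    have h' := (abs_le.1 (h.trans hgz₁)).1
    have hY2 : (2 : ℝ) ≤ Y := by rw [hY]; nlinarith [sq_nonneg R, hR.le]
    linarith
  -- the Cayley transform of `g` has modulus `< 1` on `Δ` (maximum modulus principle)
  set ρ : ℂ → ℂ := fun z ↦ cayleyFun (g z) with hρ
  have hρd : DifferentiableOn ℂ ρ Δ :=
    differentiableOn_cayleyFun.comp hgd fun z hz ↦ add_I_ne_zero (him z hz)
  have hρle : ∀ z ∈ Δ, ‖ρ z‖ ≤ 1 := fun z hz ↦ norm_cayleyFun_le_one (him z hz)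
  have hρz₁ : ‖ρ z₁‖ < 1 := (norm_cayleyFun_lt_one_iff (add_I_ne_zero (him z₁ hz₁Δ))).2 hgz₁im
  have hρlt : ∀ z ∈ Δ, ‖ρ z‖ < 1 := by
    intro z hz
    by_contra hge
    have h1 : ‖ρ z‖ = 1 := le_antisymm (hρle z hz) (not_lt.1 hge)
    have hmax : IsMaxOn (norm ∘ ρ) Δ z := fun y hy ↦ by
      change ‖ρ y‖ ≤ ‖ρ z‖
      rw [h1]
      exact hρle y hy
    have heq := Complex.eqOn_of_isPreconnected_of_isMaxOn_norm hΔconn hΔo hρd hz hmax hz₁Δ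
    rw [Function.const_apply] at heq
    rw [heq, h1] at hρz₁
    exact lt_irrefl _ hρz₁
  have hgH : MapsTo g Δ upperHalfPlaneSet := fun z hz ↦
    (norm_cayleyFun_lt_one_iff (add_I_ne_zero (him z hz))).1 (hρlt z hz)
  refine ⟨fun k ↦ σ₀ k + N, hσ₀.add_const N, fun k ↦ htail (σ₀ k), g, hgd, hgH, hlim⟩

/-- **The kernel theorem, inverse maps, along a subsequence.** Under the hypotheses of
`tendstoLocallyUniformlyOn_symm_of_thickening`, some subsequence of `(g_n⁻¹)` converges to
`g⁻¹` locally uniformly on `ℍ` (Montel for `g_n⁻¹ - id`; Hurwitz; Rouché against moving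
targets `q_n ∈ S_n`; the Montel step on `ℍ ∖ K`; uniqueness of `g_K`).
[cite: PommerenkeBBCM1992, Thm. 1.8] [cite: KemppainenSmirnov2017, App. A Lemma A.2] -/
theorem exists_strictMono_tendstoLocallyUniformlyOn_symm (hR : 0 < R)
    (hSR : S ⊆ closedBall (0 : ℂ) R) (hSnR : ∀ n, Sn n ⊆ closedBall (0 : ℂ) R)
    (hV : upperHalfPlaneSet \ K = Loewner.unboundedComponent (upperHalfPlaneSet \ S))
    (hVn : ∀ n, upperHalfPlaneSet \ Kn n = Loewner.unboundedComponent (upperHalfPlaneSet \ Sn n))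
    (hφ : IsHydrodynamicMap K φ) (hφn : ∀ n, IsHydrodynamicMap (Kn n) (φn n))
    (h1 : ∀ ε > 0, ∀ᶠ n in atTop, Sn n ⊆ thickening ε S)
    (h2 : ∀ ε > 0, ∀ᶠ n in atTop, S ⊆ thickening ε (Sn n)) :
    ∃ σ : ℕ → ℕ, StrictMono σ ∧
      TendstoLocallyUniformlyOn (fun k w ↦ (φn (σ k)).symm w) φ.symm atTop
        upperHalfPlaneSet := by
  have hKR : K ∩ upperHalfPlaneSet ⊆ closedBall ((0 : ℝ) : ℂ) R :=
    inter_subset_closedBall_of_diff_eq hSR hV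
  have hb : IsBounded (K ∩ upperHalfPlaneSet) := IsHydrodynamicMap.isBounded_of_subset hKR
  have hKnR : ∀ n, Kn n ∩ upperHalfPlaneSet ⊆ closedBall ((0 : ℝ) : ℂ) R := fun n ↦
    inter_subset_closedBall_of_diff_eq (hSnR n) (hVn n)
  have hbn : ∀ n, IsBounded (Kn n ∩ upperHalfPlaneSet) := fun n ↦
    IsHydrodynamicMap.isBounded_of_subset (hKnR n)
  set C : ℝ := 580 * R with hC
  have hC0 : 0 ≤ C := by positivity
  have hCn : ∀ n, ∀ z ∈ upperHalfPlaneSet \ Kn n, ‖φn n z - z‖ ≤ C := fun n z hz ↦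
    (hφn n).norm_sub_self_le (hKnR n) hR hz
  have hfar : ∀ n, ∀ z ∈ upperHalfPlaneSet, 2 * R ≤ ‖z‖ → ‖φn n z - z‖ ≤ 1152 * R ^ 2 / ‖z‖ :=
    fun n z hz hz2 ↦ (hφn n).norm_sub_self_le_div (hKnR n) hR hz hz2
  -- the inverse maps `f_n = g_n⁻¹ : ℍ → ℍ ∖ K_n`
  set f : ℕ → ℂ → ℂ := fun n w ↦ (φn n).symm w with hf
  have hfmem : ∀ n, ∀ w ∈ upperHalfPlaneSet, f n w ∈ upperHalfPlaneSet \ Kn n := fun n w hw ↦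
    (φn n).symm_mapsTo hw
  have hgf : ∀ n, ∀ w ∈ upperHalfPlaneSet, φn n (f n w) = w := fun n w hw ↦
    (φn n).apply_symm_apply hw
  have hfd : ∀ n, DifferentiableOn ℂ (f n) upperHalfPlaneSet := fun n ↦
    (φn n).symm.differentiableOn_coe
  have hfinj : ∀ n, InjOn (f n) upperHalfPlaneSet := fun n ↦ (φn n).symm.injOn
  have hfC : ∀ n, ∀ w ∈ upperHalfPlaneSet, ‖f n w - w‖ ≤ C := fun n w hw ↦ by
    have h := hCn n (f n w) (hfmem n w hw)
    rw [hgf n w hw] at h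
    rwa [norm_sub_rev]
  have hfim : ∀ n, ∀ w ∈ upperHalfPlaneSet, w.im ≤ (f n w).im := fun n w hw ↦ by
    have h := (hφn n).im_le (hbn n) (hfmem n w hw)
    rwa [hgf n w hw] at h
  -- the far-field bound for the inverses
  have hffar : ∀ n, ∀ w ∈ upperHalfPlaneSet, 2 * R + C ≤ ‖w‖ →
      ‖f n w - w‖ ≤ 1152 * R ^ 2 / (‖w‖ - C) := by
    intro n w hw hwR
    have hx := hfmem n w hw
    have hxn : ‖w‖ - C ≤ ‖f n w‖ := by
      linarith [hfC n w hw, norm_sub_norm_le w (f n w), norm_sub_rev w (f n w)]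
    have hx2 : 2 * R ≤ ‖f n w‖ := by linarith
    have hpos : 0 < ‖w‖ - C := by linarith
    have h := hfar n (f n w) hx.1 hx2
    rw [hgf n w hw, norm_sub_rev] at h
    refine h.trans ?_
    exact div_le_div_of_nonneg_left (by positivity) hpos hxn
  -- Step 1: Montel for `f_n - id` on `ℍ`
  obtain ⟨h, σ, hσ, hhd, hlim₁, -⟩ :=
    Complex.exists_strictMono_tendstoLocallyUniformlyOn_of_norm_le isOpen_upperHalfPlaneSet
      (F := fun n w ↦ f n w - w) (M := C) (fun n ↦ (hfd n).sub differentiableOn_id)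
      (fun n w hw ↦ hfC n w hw)
  set fs : ℂ → ℂ := fun w ↦ h w + w with hfs
  have hlimf : TendstoLocallyUniformlyOn (fun k ↦ f (σ k)) fs atTop upperHalfPlaneSet := by
    have := tendstoLocallyUniformlyOn_add_id hlim₁
    simp only [sub_add_cancel] at this
    exact this
  have hfsd : DifferentiableOn ℂ fs upperHalfPlaneSet := hhd.add differentiableOn_id
  have hfsC : ∀ w ∈ upperHalfPlaneSet, ‖fs w - w‖ ≤ C := fun w hw ↦
    le_of_tendsto ((hlimf.tendsto_at hw).sub_const w |>.norm)
      (Eventually.of_forall fun k ↦ hfC _ w hw)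
  have hfsim : ∀ w ∈ upperHalfPlaneSet, w.im ≤ (fs w).im := fun w hw ↦
    ge_of_tendsto ((continuous_im.tendsto _).comp (hlimf.tendsto_at hw))
      (Eventually.of_forall fun k ↦ hfim _ w hw)
  have hfsH : MapsTo fs upperHalfPlaneSet upperHalfPlaneSet := fun w hw ↦
    show 0 < (fs w).im from lt_of_lt_of_le hw (hfsim w hw)
  have hfsfar : ∀ w ∈ upperHalfPlaneSet, 2 * R + C ≤ ‖w‖ →
      ‖fs w - w‖ ≤ 1152 * R ^ 2 / (‖w‖ - C) := fun w hw hwR ↦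
    le_of_tendsto ((hlimf.tendsto_at hw).sub_const w |>.norm)
      (Eventually.of_forall fun k ↦ hffar _ w hw hwR)
  -- Step 2: `fs` is not constant and is injective on `ℍ`
  have hfs_nc : ¬ ∃ c, EqOn fs (const ℂ c) upperHalfPlaneSet := by
    rintro ⟨c, hc⟩
    have hw : ((|c.im| + 1 : ℝ) : ℂ) * I ∈ upperHalfPlaneSet := by
      show 0 < (((|c.im| + 1 : ℝ) : ℂ) * I).im
      simp; positivity
    have h1 := hfsim _ hw
    rw [hc hw] at h1
    simp [const] at h1
    linarith [le_abs_self c.im]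
  have hfsinj : InjOn fs upperHalfPlaneSet := by
    rcases Complex.exists_eqOn_const_or_injOn_of_tendstoLocallyUniformlyOn isOpen_upperHalfPlaneSet
        (convex_halfSpace_im_gt 0).isPreconnected (Eventually.of_forall fun k ↦ hfd (σ k))
        (Eventually.of_forall fun k ↦ hfinj (σ k)) hlimf with h | h
    · exact absurd h hfs_nc
    · exact h
  -- Step 3: `fs(ℍ)` misses `S` (Rouché against targets `q_k ∈ S_{σ k}`, `q_k → p`)
  have hfs_S : ∀ w ∈ upperHalfPlaneSet, fs w ∉ S := by
    intro w₀ hw₀ hpS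
    set p₀ : ℂ := fs w₀ with hp₀
    have hp₀H : 0 < p₀.im := hfsH hw₀
    have h2' : ∀ ε > 0, ∀ᶠ k in atTop, p₀ ∈ thickening ε (Sn (σ k)) := fun ε hε ↦
      (hσ.tendsto_atTop.eventually (h2 ε hε)).mono fun k hk ↦ hk hpS
    obtain ⟨q, hq, hqmem⟩ := exists_seq_tendsto_mem_of_thickening h2'
    have hqH : ∀ᶠ k in atTop, 0 < (q k).im :=
      ((continuous_im.tendsto p₀).comp hq).eventually_const_lt hp₀H
    -- a closed disc about `w₀` inside `ℍ`
    set r : ℝ := w₀.im / 2 with hr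
    have hr0 : 0 < r := by rw [hr]; exact half_pos hw₀
    have hball : closedBall w₀ r ⊆ upperHalfPlaneSet := fun z hz ↦ by
      have h1 : |z.im - w₀.im| ≤ r := (abs_im_le_norm (z - w₀)).trans (by
        simpa [dist_eq_norm, sub_im] using (mem_closedBall.1 hz))
      change 0 < z.im
      have := (abs_le.1 h1).1
      change 0 < w₀.im at hw₀
      linarith
    have hunif : TendstoUniformlyOn (fun k ↦ f (σ k)) fs atTop (closedBall w₀ r) :=
      (tendstoLocallyUniformlyOn_iff_forall_isCompact isOpen_upperHalfPlaneSet).1 hlimf _ hball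
        (isCompact_closedBall _ _)
    have hunif' : TendstoUniformlyOn (fun k z ↦ f (σ k) z - q k) (fun z ↦ fs z - p₀) atTop
        (closedBall w₀ r) := hunif.sub (hq.tendstoUniformlyOn_const (closedBall w₀ r))
    have hF : ∀ᶠ k in atTop, DiffContOnCl ℂ (fun z ↦ f (σ k) z - q k) (ball w₀ r) :=
      Eventually.of_forall fun k ↦ ((hfd (σ k)).sub_const _).diffContOnCl_ball hball
    have hfc : ContinuousOn (fun z ↦ fs z - p₀) (sphere w₀ r) :=
      (hfsd.continuousOn.mono (sphere_subset_closedBall.trans hball)).sub continuousOn_const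
    have hf0 : fs w₀ - p₀ = 0 := by rw [hp₀, sub_self]
    have hsphere : ∀ z ∈ sphere w₀ r, fs z - p₀ ≠ 0 := by
      intro z hz h0
      have hzw : z ≠ w₀ := by
        intro heq
        rw [heq, mem_sphere, dist_self] at hz
        exact hr0.ne hz
      rw [sub_eq_zero, hp₀] at h0
      exact hzw (hfsinj (hball (sphere_subset_closedBall hz)) hw₀ h0)
    obtain ⟨k, ⟨z, hz, hzero⟩, hkq, hkH⟩ :=
      ((Complex.eventually_exists_zero_mem_ball_of_tendstoUniformlyOn hr0 hF hunif' hfc hf0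
        hsphere).and (hqmem.and hqH)).exists
    have hzH : z ∈ upperHalfPlaneSet := hball (ball_subset_closedBall hz)
    rw [sub_eq_zero] at hzero
    -- `f_{σ k}(z) = q_k ∈ S_{σ k} ∩ ℍ`, but `f_{σ k}(z)` lies in the unbounded component
    have hmem := hfmem (σ k) z hzH
    rw [hzero, hVn (σ k)] at hmem
    exact (Loewner.unboundedComponent_subset _ hmem).2 hkq
  -- Step 4: `fs(ℍ) ⊆ ℍ ∖ K`
  have hfsV : MapsTo fs upperHalfPlaneSet (upperHalfPlaneSet \ K) := by
    have hpre : IsPreconnected (fs '' upperHalfPlaneSet) :=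
      (convex_halfSpace_im_gt 0).isPreconnected.image _ hfsd.continuousOn
    have hsub : fs '' upperHalfPlaneSet ⊆ upperHalfPlaneSet \ S := by
      rintro _ ⟨w, hw, rfl⟩
      exact ⟨hfsH hw, hfs_S w hw⟩
    have hnb : ¬ IsBounded (fs '' upperHalfPlaneSet) := by
      intro hbd
      obtain ⟨R', hR'⟩ := hbd.subset_closedBall 0
      set M : ℝ := |R'| + C + 1 with hM
      have hMpos : 0 < M := by positivity
      have hw : ((M : ℂ) * I) ∈ upperHalfPlaneSet := by
        show 0 < ((M : ℂ) * I).im; simpa using hMpos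
      have h3 := hfsC _ hw
      have h4 : ‖(M : ℂ) * I‖ = M := by simp [abs_of_pos hMpos]
      have h5 : ‖fs (M * I)‖ ≤ R' := by simpa using hR' ⟨_, hw, rfl⟩
      have h6 : ‖(M : ℂ) * I‖ ≤ ‖fs (M * I)‖ + ‖fs (M * I) - M * I‖ := by
        calc ‖(M : ℂ) * I‖ = ‖fs (M * I) - (fs (M * I) - M * I)‖ := by rw [sub_sub_cancel]
          _ ≤ _ := norm_sub_le _ _
      rw [h4] at h6
      linarith [le_abs_self R']
    have key := subset_unboundedComponent_of_isPreconnected hpre hsub hnb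
    intro w hw
    rw [hV]
    exact key ⟨w, hw, rfl⟩
  -- Step 5: `ℍ ∖ K ⊆ fs(ℍ)` (the Montel step on `ℍ ∖ K`)
  have hsurj : SurjOn fs upperHalfPlaneSet (upperHalfPlaneSet \ K) := by
    intro w hwV
    obtain ⟨Δ, -, hwΔ, -, hΔ⟩ := exists_nhd_tendstoLocallyUniformlyOn_of_thickening hR hSR
      hSnR hV hVn φ hφn h1 hwV
    obtain ⟨σ', hσ', hΔn, g, -, hgH, hglim⟩ := hΔ σ hσ
    set ζ : ℂ := g w with hζ
    have hζH : ζ ∈ upperHalfPlaneSet := hgH hwΔ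
    have hwn : ∀ k, w ∈ upperHalfPlaneSet \ Kn (σ (σ' k)) := fun k ↦ hΔn k hwΔ
    have hglimw : Tendsto (fun k ↦ φn (σ (σ' k)) w) atTop (𝓝 ζ) := hglim.tendsto_at hwΔ
    have hsub : TendstoLocallyUniformlyOn (fun k ↦ f (σ (σ' k))) fs atTop upperHalfPlaneSet :=
      Loewner.tendstoLocallyUniformlyOn_comp_of_tendsto_atTop hlimf hσ'.tendsto_atTop
    have hlim2 : Tendsto (fun k ↦ f (σ (σ' k)) (φn (σ (σ' k)) w)) atTop (𝓝 (fs ζ)) :=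
      hsub.tendsto_comp (hfsd.continuousOn.continuousWithinAt hζH) hζH
        (tendsto_nhdsWithin_iff.2 ⟨hglimw, Eventually.of_forall fun k ↦ (φn _).mapsTo (hwn k)⟩)
    have hconst : (fun k ↦ f (σ (σ' k)) (φn (σ (σ' k)) w)) = fun _ ↦ w :=
      funext fun k ↦ (φn _).symm_apply_apply (hwn k)
    rw [hconst, tendsto_const_nhds_iff] at hlim2
    exact ⟨ζ, hζH, hlim2.symm⟩
  -- Step 6: the inverse of `fs` is the hydrodynamic map of `K`, so `fs = φ⁻¹`
  have hfsbij : BijOn fs upperHalfPlaneSet (upperHalfPlaneSet \ K) := ⟨hfsV, hfsinj, hsurj⟩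
  have hgsd : DifferentiableOn ℂ (invFunOn fs upperHalfPlaneSet) (upperHalfPlaneSet \ K) := by
    rw [← hfsbij.image_eq]
    exact Complex.differentiableOn_invFunOn_image isOpen_upperHalfPlaneSet hfsd hfsinj fun z hz ↦
      Literature.Analysis.Complex.SCV.deriv_ne_zero_of_injOn hfsd isOpen_upperHalfPlaneSet hfsinj hz
  set Θ : ConformalEquiv upperHalfPlaneSet (upperHalfPlaneSet \ K) :=
    ConformalEquiv.ofBijOn fs hfsd hfsbij hgsd with hΘ
  set Φs : ConformalEquiv (upperHalfPlaneSet \ K) upperHalfPlaneSet := Θ.symm with hΦs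
  have hinv : InvOn (invFunOn fs upperHalfPlaneSet) fs upperHalfPlaneSet (upperHalfPlaneSet \ K) :=
    hfsbij.invOn_invFunOn
  have hΦs_apply : ∀ z, Φs z = invFunOn fs upperHalfPlaneSet z := fun z ↦ rfl
  have hΦsfs : ∀ w ∈ upperHalfPlaneSet, Φs (fs w) = w := fun w hw ↦ by
    rw [hΦs_apply]; exact hinv.1 hw
  have hfsΦs : ∀ z ∈ upperHalfPlaneSet \ K, fs (Φs z) = z := fun z hz ↦ by
    rw [hΦs_apply]; exact hinv.2 hz
  have hΦsH : ∀ z ∈ upperHalfPlaneSet \ K, Φs z ∈ upperHalfPlaneSet := fun z hz ↦ Φs.mapsTo hz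
  have hΦsC : ∀ z ∈ upperHalfPlaneSet \ K, ‖Φs z - z‖ ≤ C := fun z hz ↦ by
    have h := hfsC (Φs z) (hΦsH z hz)
    rw [hfsΦs z hz] at h
    rwa [norm_sub_rev]
  -- `fs(u) - u → 0` at `∞` in `ℍ`
  have hfs_tend : Tendsto (fun u ↦ fs u - u) (cocompact ℂ ⊓ 𝓟 upperHalfPlaneSet) (𝓝 0) := by
    rw [Metric.tendsto_nhds]
    intro δ hδ
    rw [eventually_inf_principal, ← cobounded_eq_cocompact, hasBasis_cobounded_norm.eventually_iff]
    refine ⟨max (2 * R + C) (C + 1152 * R ^ 2 / δ) + 1, trivial, fun u hu huH ↦ ?_⟩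
    simp only [mem_setOf_eq] at hu
    have hu1 : 2 * R + C ≤ ‖u‖ := by linarith [le_max_left (2 * R + C) (C + 1152 * R ^ 2 / δ)]
    have hu2 : C + 1152 * R ^ 2 / δ < ‖u‖ := by
      linarith [le_max_right (2 * R + C) (C + 1152 * R ^ 2 / δ)]
    rw [dist_zero_right]
    refine lt_of_le_of_lt (hfsfar u huH hu1) ?_
    have hpos : 0 < ‖u‖ - C := by linarith
    rw [div_lt_iff₀ hpos]
    have h3 : 1152 * R ^ 2 / δ < ‖u‖ - C := by linarith
    rw [div_lt_iff₀ hδ] at h3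
    linarith
  have hΦs_tend : Tendsto Φs (cocompact ℂ ⊓ 𝓟 (upperHalfPlaneSet \ K))
      (cocompact ℂ ⊓ 𝓟 upperHalfPlaneSet) := by
    refine tendsto_inf.2 ⟨tendsto_cocompact_of_norm_sub_self_le (C := C) inf_le_left ?_,
      tendsto_principal.2 ?_⟩
    · filter_upwards [mem_inf_of_right (mem_principal_self _)] with z hz using hΦsC z hz
    · filter_upwards [mem_inf_of_right (mem_principal_self _)] with z hz using hΦsH z hz
  have hΦshyd : IsHydrodynamicMap K Φs := by
    change Tendsto (fun z ↦ Φs z - z) (cocompact ℂ ⊓ 𝓟 (upperHalfPlaneSet \ K)) (𝓝 0)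
    have h3 := (hfs_tend.comp hΦs_tend).neg
    rw [neg_zero] at h3
    refine h3.congr' ?_
    filter_upwards [mem_inf_of_right (mem_principal_self _)] with z hz
    simp only [comp_apply]
    rw [hfsΦs z hz]
    ring
  have hΦsφ : EqOn Φs φ (upperHalfPlaneSet \ K) := hΦshyd.eqOn_of_isHydrodynamicMap hφ hb
  have hfsφ : EqOn fs φ.symm upperHalfPlaneSet := fun w hw ↦ by
    have h3 := hΦsfs w hw
    rw [hΦsφ (hfsV hw)] at h3
    calc fs w = φ.symm (φ (fs w)) := (φ.symm_apply_apply (hfsV hw)).symm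
      _ = φ.symm w := by rw [h3]
  exact ⟨σ, hσ, hlimf.congr_right hfsφ⟩

/-- **The Carathéodory kernel theorem for Hausdorff-convergent half-plane hulls, inverse maps**
(Kemppainen–Smirnov (2017), Lemma A.2, via Pommerenke's Thm. 1.8). Let `S_n, S ⊆ B̄(0, R)`, let
`ℍ ∖ K_n`, `ℍ ∖ K` be the unbounded components of `ℍ ∖ S_n`, `ℍ ∖ S`, let
`g_n : ℍ ∖ K_n → ℍ` and `g : ℍ ∖ K → ℍ` be hydrodynamically normalized conformal maps, and
suppose `S_n → S` in the Hausdorff sense: for every `ε > 0`, eventually `S_n ⊆ S^ε` and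
`S ⊆ S_n^ε`. Then `g_n⁻¹ → g⁻¹` locally uniformly on `ℍ`.
[cite: KemppainenSmirnov2017, App. A Lemma A.2] [cite: PommerenkeBBCM1992, Thm. 1.8] -/
theorem tendstoLocallyUniformlyOn_symm_of_thickening (hR : 0 < R)
    (hSR : S ⊆ closedBall (0 : ℂ) R) (hSnR : ∀ n, Sn n ⊆ closedBall (0 : ℂ) R)
    (hV : upperHalfPlaneSet \ K = Loewner.unboundedComponent (upperHalfPlaneSet \ S))
    (hVn : ∀ n, upperHalfPlaneSet \ Kn n = Loewner.unboundedComponent (upperHalfPlaneSet \ Sn n))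
    (hφ : IsHydrodynamicMap K φ) (hφn : ∀ n, IsHydrodynamicMap (Kn n) (φn n))
    (h1 : ∀ ε > 0, ∀ᶠ n in atTop, Sn n ⊆ thickening ε S)
    (h2 : ∀ ε > 0, ∀ᶠ n in atTop, S ⊆ thickening ε (Sn n)) :
    TendstoLocallyUniformlyOn (fun n w ↦ (φn n).symm w) φ.symm atTop upperHalfPlaneSet := by
  refine tendstoLocallyUniformlyOn_of_forall_strictMono isOpen_upperHalfPlaneSet fun ψ hψ ↦ ?_
  exact exists_strictMono_tendstoLocallyUniformlyOn_symm (Kn := fun k ↦ Kn (ψ k))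
    (φn := fun k ↦ φn (ψ k)) hR hSR (fun k ↦ hSnR (ψ k)) hV (fun k ↦ hVn (ψ k)) hφ
    (fun k ↦ hφn (ψ k)) (fun ε hε ↦ hψ.tendsto_atTop.eventually (h1 ε hε))
    (fun ε hε ↦ hψ.tendsto_atTop.eventually (h2 ε hε))

/-- **The Carathéodory kernel theorem for Hausdorff-convergent half-plane hulls, the maps**
(Kemppainen–Smirnov (2017), Lemma A.2: "`g_{n,t} → g_t` uniformly on" compact subsets at
positive distance from the hull). Under the hypotheses of
`tendstoLocallyUniformlyOn_symm_of_thickening`, `g_n → g` locally uniformly on `ℍ ∖ K`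
(in particular every compact subset of `ℍ ∖ K` lies in `ℍ ∖ K_n` for all large `n`, the maps
being compared where both are defined). [cite: KemppainenSmirnov2017, App. A Lemma A.2]
[cite: PommerenkeBBCM1992, Thm. 1.8] -/
theorem tendstoLocallyUniformlyOn_of_thickening (hR : 0 < R)
    (hSR : S ⊆ closedBall (0 : ℂ) R) (hSnR : ∀ n, Sn n ⊆ closedBall (0 : ℂ) R)
    (hV : upperHalfPlaneSet \ K = Loewner.unboundedComponent (upperHalfPlaneSet \ S))
    (hVn : ∀ n, upperHalfPlaneSet \ Kn n = Loewner.unboundedComponent (upperHalfPlaneSet \ Sn n))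
    (hφ : IsHydrodynamicMap K φ) (hφn : ∀ n, IsHydrodynamicMap (Kn n) (φn n))
    (h1 : ∀ ε > 0, ∀ᶠ n in atTop, Sn n ⊆ thickening ε S)
    (h2 : ∀ ε > 0, ∀ᶠ n in atTop, S ⊆ thickening ε (Sn n)) :
    TendstoLocallyUniformlyOn (fun n z ↦ φn n z) φ atTop (upperHalfPlaneSet \ K) := by
  have hK1 := tendstoLocallyUniformlyOn_symm_of_thickening hR hSR hSnR hV hVn hφ hφn h1 h2
  rw [Metric.tendstoLocallyUniformlyOn_iff]
  intro ε hε z₀ hz₀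
  obtain ⟨Δ, hΔo, hz₀Δ, hΔV, hΔ⟩ :=
    exists_nhd_tendstoLocallyUniformlyOn_of_thickening hR hSR hSnR hV hVn φ hφn h1 hz₀
  obtain ⟨r, hr, hball⟩ := Metric.isOpen_iff.1 hΔo z₀ hz₀Δ
  set B : Set ℂ := closedBall z₀ (r / 2) with hB
  have hBΔ : B ⊆ Δ := (closedBall_subset_ball (by linarith)).trans hball
  have hunif : TendstoUniformlyOn (fun n z ↦ φn n z) φ atTop B := by
    refine tendstoUniformlyOn_of_forall_strictMono fun ψ hψ ↦ ?_
    obtain ⟨σ, hσ, hΔn, g, -, hgH, hglim⟩ := hΔ ψ hψ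
    -- identify the limit: `g = φ` on `Δ`
    have hgφ : EqOn g φ Δ := fun z hz ↦ by
      have hzn : ∀ k, z ∈ upperHalfPlaneSet \ Kn (ψ (σ k)) := fun k ↦ hΔn k hz
      have hwlim : Tendsto (fun k ↦ φn (ψ (σ k)) z) atTop (𝓝 (g z)) := hglim.tendsto_at hz
      have hsub : TendstoLocallyUniformlyOn (fun k w ↦ (φn (ψ (σ k))).symm w) φ.symm atTop
          upperHalfPlaneSet :=
        Loewner.tendstoLocallyUniformlyOn_comp_of_tendsto_atTop hK1 (hψ.comp hσ).tendsto_atTop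
      have hlim2 : Tendsto (fun k ↦ (φn (ψ (σ k))).symm (φn (ψ (σ k)) z)) atTop
          (𝓝 (φ.symm (g z))) :=
        hsub.tendsto_comp (φ.symm.continuousOn.continuousWithinAt (hgH hz)) (hgH hz)
          (tendsto_nhdsWithin_iff.2 ⟨hwlim, Eventually.of_forall fun k ↦ (φn _).mapsTo (hzn k)⟩)
      have hconst : (fun k ↦ (φn (ψ (σ k))).symm (φn (ψ (σ k)) z)) = fun _ ↦ z :=
        funext fun k ↦ (φn _).symm_apply_apply (hzn k)
      rw [hconst, tendsto_const_nhds_iff] at hlim2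
      have h3 := congrArg φ hlim2
      rw [φ.apply_symm_apply (hgH hz)] at h3
      exact h3.symm
    exact ⟨σ, hσ, (tendstoLocallyUniformlyOn_iff_forall_isCompact hΔo).1 (hglim.congr_right hgφ)
      B hBΔ (isCompact_closedBall _ _)⟩
  exact ⟨B, mem_nhdsWithin_of_mem_nhds (closedBall_mem_nhds z₀ (half_pos hr)),
    (Metric.tendstoUniformlyOn_iff.1 hunif) ε hε⟩

/-- **Compact subsets of `ℍ ∖ K` eventually avoid `K_n`** (the domains of the kernel theorem
exhaust `ℍ ∖ K`): under the set-theoretic hypotheses of the kernel theorem, every compact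
`L ⊆ ℍ ∖ K` lies in `ℍ ∖ K_n` for all large `n`. [cite: PommerenkeBBCM1992, Thm. 1.8] -/
theorem eventually_subset_diff_of_isCompact (hSR : S ⊆ closedBall (0 : ℂ) R)
    (hSnR : ∀ n, Sn n ⊆ closedBall (0 : ℂ) R)
    (hV : upperHalfPlaneSet \ K = Loewner.unboundedComponent (upperHalfPlaneSet \ S))
    (hVn : ∀ n, upperHalfPlaneSet \ Kn n = Loewner.unboundedComponent (upperHalfPlaneSet \ Sn n))
    (φ : ConformalEquiv (upperHalfPlaneSet \ K) upperHalfPlaneSet)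
    (h1 : ∀ ε > 0, ∀ᶠ n in atTop, Sn n ⊆ thickening ε S)
    {L : Set ℂ} (hL : IsCompact L) (hLV : L ⊆ upperHalfPlaneSet \ K) :
    ∀ᶠ n in atTop, L ⊆ upperHalfPlaneSet \ Kn n := by
  have hVo : IsOpen (upperHalfPlaneSet \ K) := IsHydrodynamicMap.isOpen_diff φ
  have hVc : IsConnected (upperHalfPlaneSet \ K) := IsHydrodynamicMap.isConnected_diff φ
  have hVS : upperHalfPlaneSet \ K ⊆ upperHalfPlaneSet \ S := by
    rw [hV]; exact Loewner.unboundedComponent_subset _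
  -- a far point and a compact connected set `P ⊆ V` containing `L` and the far point
  set Y : ℝ := |R| + 1 with hY
  have hY0 : 0 < Y := by positivity
  set z₁ : ℂ := (Y : ℂ) * I with hz₁
  have hz₁H : z₁ ∈ upperHalfPlaneSet := by
    change 0 < z₁.im
    simpa [hz₁] using hY0
  have hz₁n : ‖z₁‖ = Y := by
    rw [hz₁, norm_mul, norm_I, mul_one, Complex.norm_real, Real.norm_eq_abs, abs_of_pos hY0]
  have hz₁R : R < ‖z₁‖ := by rw [hz₁n, hY]; linarith [le_abs_self R]
  have hz₁V : z₁ ∈ upperHalfPlaneSet \ K := by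
    rw [hV]
    exact mem_unboundedComponent_of_lt_norm hSR hz₁H hz₁R
  -- each point of `ℍ ∖ K` is joined to `z₁` inside `ℍ ∖ K`
  have hpath : ∀ x ∈ upperHalfPlaneSet \ K, JoinedIn (upperHalfPlaneSet \ K) x z₁ := fun x hx ↦
    ((hVo.isConnected_iff_isPathConnected).1 hVc).joinedIn x hx z₁ hz₁V
  -- for each `x ∈ ℍ ∖ K`: an open neighbourhood `Δ_x` of `x` with `Δ_x ⊆ ℍ ∖ K_n` eventually
  have hloc : ∀ x ∈ upperHalfPlaneSet \ K, ∃ Δ : Set ℂ, IsOpen Δ ∧ x ∈ Δ ∧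
      ∀ᶠ n in atTop, Δ ⊆ upperHalfPlaneSet \ Kn n := by
    intro x hx
    obtain ⟨p, hp⟩ := hpath x hx
    set P : Set ℂ := range p with hP
    have hPc : IsCompact P := isCompact_range p.continuous
    have hPconn : IsPreconnected P := isPreconnected_range p.continuous
    have hPV : P ⊆ upperHalfPlaneSet \ K := by
      rintro _ ⟨u, rfl⟩
      exact hp u
    have hxP : x ∈ P := ⟨0, p.source⟩
    have hz₁P : z₁ ∈ P := ⟨1, p.target⟩
    obtain ⟨ε2, hε2, hcth⟩ := hPc.exists_cthickening_subset_open hVo hPV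
    set ε : ℝ := ε2 / 2 with hε
    have hε0 : 0 < ε := by positivity
    set Δ : Set ℂ := thickening ε P with hΔ
    have hΔconn : IsPreconnected Δ := Loewner.isPreconnected_thickening hPconn hε0
    have hΔV : Δ ⊆ upperHalfPlaneSet \ K :=
      ((thickening_mono (by linarith) P).trans (thickening_subset_cthickening ε2 P)).trans hcth
    have hΔH : Δ ⊆ upperHalfPlaneSet := fun z hz ↦ (hΔV hz).1
    have hΔS : Disjoint (thickening ε Δ) S := by
      rw [Set.disjoint_left]
      intro y hy hyS
      obtain ⟨d, hd, hyd⟩ := mem_thickening_iff.1 hy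
      obtain ⟨k, hk, hdk⟩ := mem_thickening_iff.1 hd
      have h3 : y ∈ thickening ε2 P := mem_thickening_iff.2 ⟨k, hk, by
        calc dist y k ≤ dist y d + dist d k := dist_triangle _ _ _
          _ < ε + ε := add_lt_add hyd hdk
          _ = ε2 := by rw [hε]; ring⟩
      exact (hVS (hcth (thickening_subset_cthickening ε2 P h3))).2 hyS
    exact ⟨Δ, isOpen_thickening, self_subset_thickening hε0 P hxP,
      eventually_subset_diff_of_thickening hSnR hVn h1 hΔconn hΔH hε0 hΔS
        (self_subset_thickening hε0 P hz₁P) hz₁R⟩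
  -- compactness of `L`
  choose! Δ hΔo hxΔ hΔev using hloc
  obtain ⟨t, htL, htfin, hcover⟩ := hL.elim_finite_subcover_image
    (fun x hx ↦ hΔo x (hLV hx)) (fun x hx ↦ mem_iUnion₂.2 ⟨x, hx, hxΔ x (hLV hx)⟩)
  have hall : ∀ᶠ n in atTop, ∀ x ∈ t, Δ x ⊆ upperHalfPlaneSet \ Kn n :=
    htfin.eventually_all.2 fun x hx ↦ hΔev x (hLV (htL hx))
  filter_upwards [hall] with n hn z hz
  obtain ⟨x, hx, hzx⟩ := mem_iUnion₂.1 (hcover hz)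
  exact hn x hx hzx

end Kernel

end Literature.Probability.RandomPlanarGeometry
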